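import Summits.BirchSwinnertonDyer.Rank1Residual.X2.GreenbergSelmerCountNonsplit
import Literature.NumberTheory.EllipticCurves.KummerSelmerStructure
import HarnessLib

/-!
# Algebra for the trivial-zero corank shift: finiteness of `S[p]` from a kernel and a target,
# corank additivity along a homomorphism, `corank R = 1` for a nonzero divisible line, and
# `#D[p] = p` for a corank-one Greenberg datum of `E[p^∞]`

HONEST FRAMING (cell `b2b-bsdres`, run/shared/lean/b2b/bsd-rank1-residual/, verbatim in every
file): the goal of the cell is to DELETE the COMBINATION-SHAPED residual classes of the
Birch–Swinnerton-Dyer formula for ALL analytic-rank `≤ 1` elliptic curves over `ℚ` — "full BSD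
formula for every rank `≤ 1` curve in class `C`" assembled STRICTLY from published theorems — so
that the rank-`≤ 1` remainder becomes exactly the CONSTRUCTION-SHAPED classes, which are TYPED
(missing-input `Prop`s), NOT attempted. This is not "finishing BSD". Sub-cell
`b2b-bsdres-eisenstein-p2` (CLASS-OWNERS row "X2"), gen 13: research route; NO CLAIM BEYOND STATED
CLASSES; nothing here changes a label. Theorems only; axioms standard; no `sorry`.

WHAT THIS FILE PROVES (helpers of step K-C2, the split count `GreenbergSelmerCountSplit`): pure
group theory in the tree's `zpCorank` calculus —
* `exists_torsionBy_ne_zero_of_primary`, `finite_of_finite_addSubgroup_of_finite_quotient`,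
  `zpCorank_eq_one` (a nonzero `p`-divisible `p`-primary group with `#R[p] ∣ p` has corank `1`);
* generic subgroup bookkeeping kept ABSTRACT (so the kernel never unfolds Selmer groups):
  `finite_inf_torsionBy_of_le`, `finite_and_natCard_torsionBy_dvd_of_le`,
  `finite_torsionBy_of_hom` (`T ≤ S`, `Φ : S → X` with kernel `T`, `T[p]`, `X[p]` finite ⇒ `S[p]`
  finite), `zpCorank_eq_add_of_hom` (`corank S = corank T + corank Φ(S)`), `range_divisible`;
* `natCard_torsionBy_geomPrimaryTorsion` (`#E[p^∞][p] = p²`) and **`finite_and_natCard_torsionBy_gr`**: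
  `#D[p] = p` for a datum `C ⊂ E[p^∞]` with `C` divisible and `#(C ∩ E[p^∞][p]) = p` (GV p. 14
  "`D ≅ ℚ_p/ℤ_p`").

References: Greenberg–Vatsal 2000 §2 pp. 14, 16; Greenberg 1999 §1; Silverman *AEC* III.6.4.
-/

noncomputable section

open scoped Classical AddSubgroup

universe u

namespace Summit.BirchSwinnertonDyer.Rank1Residual.X2.TrivialZeroCorankAlgebra

open NumberField IsDedekindDomain Field Literature.NumberTheory.GaloisRepresentations
  Literature.NumberTheory.EllipticCurves Literature.NumberTheory.EllipticCurves.GreenbergSelmer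
  Summit.BirchSwinnertonDyer.Rank1Residual.X2.NonPrimitiveSelmerTorsionCard
  Summit.BirchSwinnertonDyer.Rank1Residual.X2.GreenbergSelmerCountNonsplit

/-! ## §1. Algebra -/

section Algebra

variable (p : ℕ) [hp : Fact p.Prime]

omit hp in
/-- A nonzero `p`-primary group has a nonzero `p`-torsion element. [folklore] -/
theorem exists_torsionBy_ne_zero_of_primary {R : Type*} [AddCommGroup R]
    (hR : ∀ r : R, ∃ n : ℕ, p ^ n • r = 0) {r : R} (hr : r ≠ 0) :
    ∃ s : R[(p : ℤ)], s ≠ 0 := by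
  classical
  obtain ⟨n, hn⟩ := hR r
  -- the least `k` with `p^k • r = 0` is positive; `p^{k-1} • r` is a nonzero `p`-torsion element
  have hex : ∃ k, p ^ k • r = 0 := ⟨n, hn⟩
  set k := Nat.find hex with hk
  have hk0 : p ^ k • r = 0 := Nat.find_spec hex
  have hkpos : k ≠ 0 := by
    intro h0
    rw [h0, pow_zero, one_nsmul] at hk0
    exact hr hk0
  obtain ⟨j, hj⟩ := Nat.exists_eq_succ_of_ne_zero hkpos
  have hjlt : ¬ p ^ j • r = 0 := Nat.find_min hex (by rw [← hk, hj]; exact Nat.lt_succ_self j)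
  refine ⟨⟨p ^ j • r, ?_⟩, fun h ↦ hjlt (congrArg Subtype.val h)⟩
  rw [mem_torsionBy_iff, natCast_zsmul, ← mul_nsmul', ← pow_succ']
  have h := hk0
  rw [hj] at h
  exact h

/-- An additive group with a finite subgroup of finite index... : `G` is finite if `K ≤ G` and
`G ⧸ K` are. [folklore] -/
theorem finite_of_finite_addSubgroup_of_finite_quotient {G : Type*} [AddCommGroup G]
    (K : AddSubgroup G) [Finite K] [Finite (G ⧸ K)] : Finite G := by
  apply Nat.finite_of_card_ne_zero
  rw [AddSubgroup.card_eq_card_quotient_mul_card_addSubgroup K]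
  exact mul_ne_zero Nat.card_pos.ne' Nat.card_pos.ne'

/-- **`corank R = 1`** for a `p`-primary, `p`-divisible, NONZERO group `R` whose `p`-torsion injects
into a group of order `p` (`#R[p] ∣ p`, `R[p] ≠ 0` ⇒ `#R[p] = p = p^{corank R}·#(R/pR)`, `R/pR = 0`).
[folklore] -/
theorem zpCorank_eq_one {R : Type*} [AddCommGroup R] (hR : ∀ r : R, ∃ n : ℕ, p ^ n • r = 0)
    (hdiv : ∀ r : R, ∃ r' : R, p • r' = r) {r : R} (hr : r ≠ 0) [Finite (R[(p : ℤ)])]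
    (hdvd : Nat.card (R[(p : ℤ)]) ∣ p) : zpCorank R p = 1 := by
  have hcard : Nat.card (R[(p : ℤ)]) = p := by
    rcases (Nat.dvd_prime hp.out).1 hdvd with h | h
    · exfalso
      obtain ⟨s, hs⟩ := exists_torsionBy_ne_zero_of_primary p hR hr
      haveI : Subsingleton (R[(p : ℤ)]) := (Nat.card_eq_one_iff_unique.1 h).1
      exact hs (Subsingleton.elim _ _)
    · exact h
  have h := natCard_torsionBy_eq_pow_zpCorank_of_divisible p hR hdiv
  rw [hcard] at h
  have h1 : p ^ 1 = p ^ zpCorank R p := by rw [pow_one]; exact h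
  exact (Nat.pow_right_injective hp.out.two_le h1).symm

/-! ### Generic subgroup bookkeeping (kept abstract so that the kernel never unfolds Selmer groups) -/

section Generic

variable {G : Type*} [AddCommGroup G] {X : Type*} [AddCommGroup X] (n : ℤ)

/-- `A ≤ B` ⇒ `A ⊓ G[n]` embeds in `B ⊓ G[n]`; finiteness transfers. [folklore] -/
theorem finite_inf_torsionBy_of_le {A B : AddSubgroup G} (h : A ≤ B) [Finite ↥(B ⊓ G[n])] :
    Finite ↥(A ⊓ G[n]) :=
  Finite.of_injective (fun x : ↥(A ⊓ G[n]) ↦ (⟨(x : G), AddSubgroup.mem_inf.2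
      ⟨h (AddSubgroup.mem_inf.1 x.2).1, (AddSubgroup.mem_inf.1 x.2).2⟩⟩ : ↥(B ⊓ G[n])))
    fun x y hxy ↦ Subtype.ext (by have h' := congrArg Subtype.val hxy; exact h')

/-- For `R ≤ X`: `(↥R)[n]` embeds in `X[n]`; finite if `X[n]` is, of order dividing `#X[n]`.
[folklore] -/
theorem finite_and_natCard_torsionBy_dvd_of_le (R : AddSubgroup X) [Finite (X[n])] :
    Finite ((↥R)[n]) ∧ Nat.card ((↥R)[n]) ∣ Nat.card (X[n]) := by
  have h1 : Nat.card ↥(R ⊓ X[n]) ∣ Nat.card ↥(X[n]) := AddSubgroup.card_dvd_of_le inf_le_right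
  haveI : Finite ↥(R ⊓ X[n]) :=
    Finite.of_injective (fun x : ↥(R ⊓ X[n]) ↦ (⟨(x : X), (AddSubgroup.mem_inf.1 x.2).2⟩ : ↥(X[n])))
      fun x y hxy ↦ Subtype.ext (by have h' := congrArg Subtype.val hxy; exact h')
  refine ⟨(finite_inf_torsionBy_iff R n).1 inferInstance, ?_⟩
  rw [← natCard_inf_torsionBy_eq]; exact h1

variable {n}

/-- **Finiteness of `S[n]` from the kernel and the target**: `T ≤ S ≤ G`, `Φ : S → X` additive with
`Φ c = 0 ↔ c ∈ T`; if `(↥T)[n]` and `X[n]` are finite then so is `(↥S)[n]`. [folklore] -/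
theorem finite_torsionBy_of_hom {T S : AddSubgroup G} (Φ : ↥S →+ X)
    (hΦ : ∀ c : ↥S, Φ c = 0 ↔ (c : G) ∈ T) [Finite ((↥T)[n])] [Finite (X[n])] :
    Finite ((↥S)[n]) := by
  -- `ψ : S[n] → X[n]`
  let ψ : ↥((↥S)[n]) →+ ↥(X[n]) :=
    { toFun := fun x ↦ ⟨Φ (x : ↥S), by
        rw [mem_torsionBy_iff]
        have h : n • (x : ↥S) = 0 := mem_torsionBy_iff.1 x.2
        rw [← map_zsmul, h, map_zero]⟩
      map_zero' := Subtype.ext (map_zero _)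
      map_add' := fun x y ↦ Subtype.ext (map_add _ _ _) }
  -- `ker ψ ↪ T[n]` via `T ⊓ G[n]`
  haveI : Finite ↥(T ⊓ G[n]) := (finite_inf_torsionBy_iff T n).2 inferInstance
  haveI : Finite ψ.ker := by
    refine Finite.of_injective (fun x : ψ.ker ↦ (⟨((x : ↥((↥S)[n])) : ↥S),
      AddSubgroup.mem_inf.2 ⟨(hΦ _).1 (congrArg Subtype.val ((AddMonoidHom.mem_ker).1 x.2)),
        coe_mem_torsionBy_of_mem (x : ↥((↥S)[n]))⟩⟩ : ↥(T ⊓ G[n]))) fun x y hxy ↦ ?_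
    have h' := congrArg Subtype.val hxy
    apply Subtype.ext; apply Subtype.ext; apply Subtype.ext
    exact h'
  haveI : Finite (↥((↥S)[n]) ⧸ ψ.ker) :=
    Finite.of_equiv _ (QuotientAddGroup.quotientKerEquivRange ψ).symm.toEquiv
  exact finite_of_finite_addSubgroup_of_finite_quotient ψ.ker

/-- **Corank additivity along `Φ`**: `T ≤ S ≤ G`, `Φ : S → X` with kernel `T`, `S` `p`-primary with
`S[p]` finite ⇒ `corank S = corank T + corank Φ(S)` (tree `zpCorank_eq_add_of_shortExact` for
`0 → T → S → Φ(S) → 0`). [folklore] -/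
theorem zpCorank_eq_add_of_hom {T S : AddSubgroup G} (hTS : T ≤ S) (Φ : ↥S →+ X)
    (hΦ : ∀ c : ↥S, Φ c = 0 ↔ (c : G) ∈ T) (hprim : ∀ s : ↥S, ∃ k : ℕ, p ^ k • s = 0)
    [Finite ((↥S)[(p : ℤ)])] :
    zpCorank (↥S) p = zpCorank (↥T) p + zpCorank (↥Φ.range) p := by
  refine zpCorank_eq_add_of_shortExact (i := AddSubgroup.inclusion hTS) (f := Φ.rangeRestrict)
    (AddSubgroup.inclusion_injective hTS) (AddMonoidHom.rangeRestrict_surjective Φ)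
    (fun b hb ↦ ?_) (fun a ↦ ?_) hprim
  · have hb' : Φ b = 0 := congrArg Subtype.val hb
    exact ⟨⟨(b : G), (hΦ b).1 hb'⟩, Subtype.ext rfl⟩
  · apply Subtype.ext
    change Φ (AddSubgroup.inclusion hTS a) = 0
    exact (hΦ _).2 a.2

omit hp in
/-- The image of a `p`-divisible group is `p`-divisible. [folklore] -/
theorem range_divisible {S : Type*} [AddCommGroup S] (Φ : S →+ X) (hdiv : ∀ s : S, ∃ t : S, p • t = s) :
    ∀ r : ↥Φ.range, ∃ r' : ↥Φ.range, p • r' = r := by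
  rintro ⟨r, ⟨s, rfl⟩⟩
  obtain ⟨t, ht⟩ := hdiv s
  exact ⟨⟨Φ t, ⟨t, rfl⟩⟩, Subtype.ext (by change p • Φ t = Φ s; rw [← map_nsmul, ht])⟩

end Generic

end Algebra

/-! ## §2. `#D[p] = p` for a corank-one datum -/

section Datum

variable (W : WeierstrassCurve ℚ) [W.IsElliptic] (p : ℕ) [hp : Fact p.Prime]
  {v : HeightOneSpectrum (𝓞 ℚ)} (N : LocalDatum ℚ (W.geomPrimaryTorsion p) v)

/-- `#E[p^∞][p] = p²`: the `p`-torsion of `E[p^∞](\bar ℚ)` is `E[p]`. [cite: SilvermanAEC2009, Cor. III.6.4(b)] -/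
theorem natCard_torsionBy_geomPrimaryTorsion :
    Nat.card ((↥(W.geomPrimaryTorsion p))[(p : ℤ)]) = p ^ 2 := by
  have hn : ((p : ℕ) : ℤ) ≠ 0 := by exact_mod_cast hp.out.ne_zero
  have e : ↥((↥(W.geomPrimaryTorsion p))[(p : ℤ)]) ≃ ↥(W.geomTorsion (p : ℤ)) :=
    { toFun := fun x ↦ ⟨((x : W.geomPrimaryTorsion p) : W.geomPoints), by
        rw [W.mem_geomTorsion_iff]
        have h := x.2
        rw [mem_torsionBy_iff] at h
        have h' : (p : ℤ) • (x : W.geomPrimaryTorsion p) = 0 := h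
        rw [← AddSubgroupClass.coe_zsmul, h', ZeroMemClass.coe_zero]⟩
      invFun := fun P ↦ ⟨⟨(P : W.geomPoints), by
          rw [WeierstrassCurve.geomPrimaryTorsion, AddCommGroup.mem_primaryComponent]
          refine ⟨1, ?_⟩
          have h := (W.mem_geomTorsion_iff (p : ℤ) _).mp P.2
          rwa [pow_one, ← natCast_zsmul]⟩, by
        rw [mem_torsionBy_iff]
        apply Subtype.ext
        change (((p : ℤ) • (⟨(P : W.geomPoints), _⟩ : W.geomPrimaryTorsion p) :
          W.geomPrimaryTorsion p) : W.geomPoints) = 0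
        rw [AddSubgroupClass.coe_zsmul]
        exact (W.mem_geomTorsion_iff (p : ℤ) _).mp P.2⟩
      left_inv := fun x ↦ by ext; rfl
      right_inv := fun P ↦ by ext; rfl }
  rw [Nat.card_congr e, W.natCard_geomTorsion (p : ℤ) hn]
  simp

/-- **`D[p]` is finite of order `p`** for a datum `C ⊂ E[p^∞]` with `C` divisible and `#(C ∩ E[p^∞][p]) = p`
(`E[p^∞][p] ↠ D[p]` using divisibility of `C`, kernel `C ∩ E[p^∞][p]`; `p²/p = p`): `D ≅ ℚ_p/ℤ_p`,
GV p. 14. [cite: GreenbergVatsal2000, §2 p. 14] -/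
theorem finite_and_natCard_torsionBy_gr
    (hCdiv : ∀ c ∈ N.plus, ∃ c' ∈ N.plus, p • c' = c)
    (hCp : Nat.card ↥(N.plus ⊓ (↥(W.geomPrimaryTorsion p))[(p : ℤ)]) = p) :
    Finite (N.Gr[(p : ℤ)]) ∧ Nat.card (N.Gr[(p : ℤ)]) = p := by
  -- the map `A[p] → D[p]`
  let π : ↥((↥(W.geomPrimaryTorsion p))[(p : ℤ)]) →+ ↥(N.Gr[(p : ℤ)]) :=
    { toFun := fun x ↦ ⟨N.grMk (x : W.geomPrimaryTorsion p), by
        rw [mem_torsionBy_iff]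
        have h := x.2
        rw [mem_torsionBy_iff] at h
        have h' : (p : ℤ) • (x : W.geomPrimaryTorsion p) = 0 := h
        change (p : ℤ) • N.grMk (x : W.geomPrimaryTorsion p) = 0
        rw [← map_zsmul, h', map_zero]⟩
      map_zero' := Subtype.ext (map_zero _)
      map_add' := fun x y ↦ Subtype.ext (map_add _ _ _) }
  -- surjective (divisibility of `C`)
  have hπs : Function.Surjective π := by
    rintro ⟨d, hd⟩
    obtain ⟨m, rfl⟩ := N.grMk_surjective d
    rw [mem_torsionBy_iff] at hd
    have hd' : (p : ℤ) • N.grMk m = 0 := hd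
    rw [← map_zsmul, ← AddMonoidHom.mem_ker, LocalDatum.ker_grMk, natCast_zsmul] at hd'
    obtain ⟨c, hc, hcm⟩ := hCdiv _ hd'
    refine ⟨⟨m - c, ?_⟩, Subtype.ext ?_⟩
    · rw [mem_torsionBy_iff]
      change (p : ℤ) • (m - c) = 0
      rw [natCast_zsmul, smul_sub, hcm, sub_self]
    · change N.grMk (m - c) = N.grMk m
      rw [map_sub, sub_eq_self, ← AddMonoidHom.mem_ker, LocalDatum.ker_grMk]; exact hc
  -- kernel `= C ∩ A[p]`, of order `p`
  have hker : Nat.card π.ker = p := by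
    refine Eq.trans (Nat.card_congr ?_) hCp
    exact
      { toFun := fun x ↦ ⟨((x : ↥((↥(W.geomPrimaryTorsion p))[(p : ℤ)])) : W.geomPrimaryTorsion p),
          AddSubgroup.mem_inf.2 ⟨by
            have h := x.2
            rw [AddMonoidHom.mem_ker] at h
            have h' : N.grMk ((x : ↥((↥(W.geomPrimaryTorsion p))[(p : ℤ)])) :
              W.geomPrimaryTorsion p) = 0 := congrArg Subtype.val h
            rw [← AddMonoidHom.mem_ker, LocalDatum.ker_grMk] at h'
            exact h', (x : ↥((↥(W.geomPrimaryTorsion p))[(p : ℤ)])).2⟩⟩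
        invFun := fun y ↦ ⟨⟨(y : W.geomPrimaryTorsion p), (AddSubgroup.mem_inf.1 y.2).2⟩, by
          rw [AddMonoidHom.mem_ker]
          apply Subtype.ext
          change N.grMk (y : W.geomPrimaryTorsion p) = 0
          rw [← AddMonoidHom.mem_ker, LocalDatum.ker_grMk]
          exact (AddSubgroup.mem_inf.1 y.2).1⟩
        left_inv := fun x ↦ by ext; rfl
        right_inv := fun y ↦ by ext; rfl }
  haveI : Finite ↥((↥(W.geomPrimaryTorsion p))[(p : ℤ)]) :=
    Nat.finite_of_card_ne_zero (by rw [natCard_torsionBy_geomPrimaryTorsion W p]; exact pow_ne_zero _ hp.out.ne_zero)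
  have hfin : Finite ↥(N.Gr[(p : ℤ)]) := Finite.of_surjective π hπs
  refine ⟨hfin, ?_⟩
  -- `#A[p] = #ker · #D[p]`
  have h := π.ker.card_eq_card_quotient_mul_card_addSubgroup
  rw [Nat.card_congr (QuotientAddGroup.quotientKerEquivOfSurjective π hπs).toEquiv, hker,
    natCard_torsionBy_geomPrimaryTorsion W p, pow_two] at h
  exact (Nat.eq_of_mul_eq_mul_right hp.out.pos h).symm

end Datum

end Summit.BirchSwinnertonDyer.Rank1Residual.X2.TrivialZeroCorankAlgebra

end
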